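import Summits.Ventures.HodgeKum4.Theorems.KummerFixedLocusKummerDivisorClassLefschetz
import Literature.AlgebraicGeometry.Hyperkaehler.GeneralizedKummerAutFixingH2H3
import Literature.AlgebraicTopology.SingularHomology.FreeActionLefschetzNumber
import HarnessLib

/-!
# The bridge `im θ* = H*(K)^{Γ(K)}` (route item `KummerRangeEqInvariants`, `stmt-Ventures-20143`; stub 3 of the line
`Cruxes/LefschetzGenerationKum4/Lines/laneV.lean` of the crux `LefschetzGenerationKum4`) — PROVED modulo print

Cell `hodge-kum4` (ladder HodgeAV rung H3), lane (V).  `Summit.Ventures.HodgeKum4.KummerRangeEqInvariants`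
(`Theorems/LaneVDefs.lean` §4): for an abelian surface `A`, `n ≥ 2`, a Hilbert scheme `(H, Ξ)` of `n + 1` points
(smooth projective of dimension `2(n+1)`) and a generalized Kummer fibre `j : K ⟶ H` (`K` smooth projective of
dimension `2n`), the image of `θ* = j(ℂ)^*` on the total cohomology is the submodule `gammaInvariantClasses K` of
classes invariant under `Γ(K) = autFixingH2H3 K`.  This file proves it from exactly TWO refereed print facts:

* `HilbertScheme.Beauville1983_kummerCover_galois` (Beauville 1983 §7 footnote 2 / Kapfer–Menet Lemma 5.4): Beauville's
  cover `Θ = kummerCover act j : A × K → H`, `(a, ξ) ↦ t_a(j ξ)`, is a finite Galois cover on complex points whose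
  deck transformations are the maps `(t_{b⁻¹} × τ_b)(ℂ)`, `b ∈ A[n+1]`, `τ_b` the Kummer translation;
* `Hyperkaehler.BNWS2011_autFixingH2H3_generalizedKummer` (Boissière–Nieper-Wißkirchen–Sarti 2011 Cor. 3.3, Oguiso
  2020 Lemma 3.4, Foster 2024 Lemma 85): `Γ(Kⁿ(A))` consists exactly of the Kummer translations `τ_b`, `b ∈ A[n+1]`
  (`n ≥ 2`; false for `n = 1`).

## Proof

(⊆) `Γ(K)` fixes `im θ*` pointwise: every `g ∈ Γ(K)` is a `τ_b`, and `τ_b^* θ^* = θ^* (t_b^{[n+1]})^* = θ^*`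
(`BNWS2011_autFixingH2H3_generalizedKummer.complexBetti_map_pullback_apply_of_mem`, in the tree).
(⊇) — `exists_map_eq_of_kummerTranslation_invariant`: for `x ∈ Hᵏ(K(ℂ); ℂ)` fixed by all Kummer translations put
`y := pr_K^* x ∈ Hᵏ((A × K)(ℂ); ℂ)`; each deck map `(t_{b⁻¹} × τ_b)(ℂ)` fixes `y` (it covers `τ_b` under `pr_K`), so
`y = Θ(ℂ)^* z` by the transfer argument for finite Galois covers (Hatcher Prop. 3G.1, the tree's
`FiniteDeckCover.mem_range_map_proj_iff`); restricting along the unit section `ι = (e, id) : K → A × K` (`pr_K ∘ ι = id`,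
`Θ ∘ ι = j` — `unitSection_comp_kummerCover`, from `t_e^{[n+1]} = 𝟙`) gives `x = ι^* y = j(ℂ)^* z`.  A `Γ(K)`-invariant
class is fixed by all `τ_b` (they lie in `Γ(K)`, BNWS clause (1)), and the total statement follows componentwise
(`apply_totalPullback`).

NO Künneth, NO `b₁(K) = 0`, NO Göttsche: the antecedent list is exactly the two facts above.  HONEST FRAMING:
conditional on them (hypotheses); nothing here asserts V0, L1, `HC_Kum4Type` or HC.
-/

noncomputable section

open CategoryTheory MonoidalCategory CartesianMonoidalCategory DirectSum
open Literature.AlgebraicTopology.SingularHomology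
open Literature.AlgebraicGeometry Literature.AlgebraicGeometry.Hyperkaehler Literature.AlgebraicGeometry.HilbertScheme
open Literature.AlgebraicGeometry.Motives (SchemeOver ComplexPoints IsSmoothProjective AbelianVariety)
open Literature.AlgebraicGeometry.HodgeTheory (complexBetti)

namespace Summit.Ventures.HodgeKum4

open scoped MonObj

/-! ### §1 Plumbing: `f^*` on the total cohomology is componentwise -/

/-- `(f^* v)_k = f^*(v_k)`: the pull-back on `H*(Y') = ⨁ₖ Hᵏ(Y')` acts componentwise. -/
theorem apply_totalPullback {Y Y' : Type} [TopologicalSpace Y] [TopologicalSpace Y'] (f : C(Y, Y'))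
    (v : totalCohomology ℂ Y') (k : ℕ) :
    (totalPullback ℂ f v) k = singularCohomology.map ℂ ℂ f k (v k) := by
  induction v using DirectSum.induction_on with
  | zero => rw [map_zero, DirectSum.zero_apply, DirectSum.zero_apply, map_zero]
  | of i x =>
    rw [← lof_eq_of ℂ, totalPullback_lof, lof_eq_of, lof_eq_of]
    by_cases hik : i = k
    · subst hik
      rw [of_eq_same, of_eq_same]
    · rw [of_apply, of_apply, dif_neg hik, dif_neg hik, map_zero]
  | add v w hv hw => rw [map_add, DirectSum.add_apply, DirectSum.add_apply, hv, hw, map_add]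

/-! ### §2 The inclusion `H*(K)^{translations} ⊆ im θ*`, degreewise -/

section Transfer

variable {n : ℕ} {A : AbelianVariety ℂ} {K H : SchemeOver ℂ}

/-- **A class fixed by all Kummer translations is a restriction from the Hilbert scheme** (degree `k`).  For a
Hilbert scheme `(H, Ξ)` of `n + 1` points of the abelian surface `A` with its translation action, a Kummer fibre
`j : K ⟶ H`, and `x ∈ Hᵏ(K(ℂ); ℂ)` with `τ_b^* x = x` for every `(n+1)`-torsion point `b` and Kummer translation `τ_b`:
`x = j(ℂ)^* z` for some `z ∈ Hᵏ(H(ℂ); ℂ)`.  Transfer for Beauville's Galois cover `Θ : A × K → H` (hypothesis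
`hGal`): `pr_K^* x` is deck-invariant, hence `= Θ(ℂ)^* z`, and `Θ ∘ (e, id) = j`. -/
theorem exists_map_eq_of_kummerTranslation_invariant (hGal : Beauville1983_kummerCover_galois) (hA : A.dim = 2)
    (Ξ : (A.X ⊗ H).left.IdealSheafData) (𝒜 : Motives.Jacobian H) (x₀ : 𝟙_ (SchemeOver ℂ) ⟶ H) (j : K ⟶ H)
    (hHilb : IsHilbertSchemeOfPoints (n + 1) A.X H Ξ) (hH : IsSmoothProjective (2 * (n + 1)) H)
    (hsq : IsPullback j (toUnit K) (lift (𝟙 H) (toUnit H ≫ x₀) ≫ 𝒜.diff) (1 : 𝟙_ (SchemeOver ℂ) ⟶ 𝒜.J.X))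
    (hKs : IsSmoothProjective (2 * n) K) {k : ℕ} {x : complexBetti K k}
    (hx : ∀ (b : 𝟙_ (SchemeOver ℂ) ⟶ A.X) (τ : K ⟶ K), b ^ (n + 1) = 1 →
      IsKummerTranslation (translationAction hHilb) j b τ → complexBetti.map τ k x = x) :
    ∃ z : complexBetti H k, complexBetti.map j k z = x := by
  set act := translationAction hHilb with hact_def
  have hact : IsTranslationAction Ξ act := isTranslationAction_translationAction hHilb
  obtain ⟨G, _, _, _, c, hc, -, hdeck, -⟩ := hGal hA Ξ 𝒜 x₀ j act hHilb hH hsq hKs hact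
  -- `y = pr_K^* x` is invariant under every deck transformation `(t_{b⁻¹} × τ_b)(ℂ)`
  set y : complexBetti (A.X ⊗ K) k := complexBetti.map (snd A.X K) k x with hy_def
  have hy : ∀ g : G, singularCohomology.map ℂ ℂ (c.deck g) k y = y := by
    intro g
    obtain ⟨b, τ, hb, hτ, hg⟩ := hdeck g
    rw [hg, hy_def]
    change complexBetti.map (A.translate b⁻¹ ⊗ₘ τ) k (complexBetti.map (snd A.X K) k x) = _
    rw [← ModuleCat.comp_apply, ← HodgeTheory.complexBetti.map_comp, tensorHom_snd, HodgeTheory.complexBetti.map_comp,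
      ModuleCat.comp_apply, hx b τ hb hτ]
  -- transfer: `y = Θ(ℂ)^* z`
  have hG : (Fintype.card G : ℂ) ≠ 0 := Nat.cast_ne_zero.mpr Fintype.card_ne_zero
  obtain ⟨z, hz⟩ := (c.mem_range_map_proj_iff ℂ hG k y).mpr hy
  rw [hc] at hz
  refine ⟨z, ?_⟩
  -- restrict along the unit section: `x = ι^* y = ι^* Θ^* z = j^* z`
  calc complexBetti.map j k z
      = complexBetti.map (unitSection A K ≫ kummerCover act j) k z := by rw [unitSection_comp_kummerCover hHilb hact]
    _ = complexBetti.map (unitSection A K) k y := by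
        rw [HodgeTheory.complexBetti.map_comp, ModuleCat.comp_apply]
        exact congrArg _ hz
    _ = x := by
        rw [hy_def, ← ModuleCat.comp_apply, ← HodgeTheory.complexBetti.map_comp, unitSection_snd,
          HodgeTheory.complexBetti.map_id]
        rfl

end Transfer

/-! ### §3 The bridge -/

/-- **THE BRIDGE `im θ* = H*(K)^{Γ(K)}`, PROVED MODULO PRINT** (route item `KummerRangeEqInvariants`, laneV stub 3).
For `n ≥ 2`: (⊆) every `g ∈ Γ(K)` is a Kummer translation (BNWS) and fixes `im θ^*` (homotopy `t_b^{[n+1]} ≃ id`);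
(⊇) a `Γ(K)`-invariant class is fixed by every Kummer translation (they lie in `Γ(K)`, BNWS), hence componentwise a
restriction from `H` by the transfer for Beauville's cover (`exists_map_eq_of_kummerTranslation_invariant`).
CONDITIONAL on the two named print facts (hypotheses, in this order). -/
theorem kummerRangeEqInvariants_of_print (hGal : Beauville1983_kummerCover_galois)
    (hBNWS : BNWS2011_autFixingH2H3_generalizedKummer) : KummerRangeEqInvariants := by
  intro n A K H hA hn Ξ 𝒜 x₀ j hHilb hH hsq hKs
  set act := translationAction hHilb with hact_def
  have hact : IsTranslationAction Ξ act := isTranslationAction_translationAction hHilb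
  apply le_antisymm
  · -- `im θ* ⊆ H*(K)^Γ`
    rintro _ ⟨w, rfl⟩
    rw [gammaInvariantClasses, mem_invariantClasses_iff]
    rintro _ ⟨g, rfl⟩
    have hg : g.val ∈ Hyperkaehler.autFixingH2H3 K := g.property
    induction w using DirectSum.induction_on with
    | zero => rw [map_zero, map_zero]
    | of k z =>
      rw [← lof_eq_of ℂ, totalPullback_lof, totalPullback_lof]
      exact congrArg _
        (hBNWS.complexBetti_map_pullback_apply_of_mem hA hn hHilb hH hsq hKs hact hg k z)
    | add v w hv hw => rw [map_add, map_add, hv, hw]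
  · -- `H*(K)^Γ ⊆ im θ*`
    intro v hv
    classical
    rw [gammaInvariantClasses, mem_invariantClasses_iff] at hv
    -- each component of `v` is fixed by every Kummer translation, hence a restriction from `H`
    have hcomp : ∀ k, ∃ z : complexBetti H k, complexBetti.map j k z = v k := by
      intro k
      refine exists_map_eq_of_kummerTranslation_invariant hGal hA Ξ 𝒜 x₀ j hHilb hH hsq hKs fun b τ hb hτ ↦ ?_
      haveI := hBNWS.isIso hA hn hHilb hH hsq hKs hact hb hτ
      have hmem : (asIso τ : Aut K) ∈ autFixingH2H3 K := hBNWS.mem_autFixingH2H3 hA hn hHilb hH hsq hKs hact hb hτ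
      have h := congrArg (fun u : totalCohomology ℂ (ComplexPoints K) ↦ u k) (hv _ ⟨⟨asIso τ, hmem⟩, rfl⟩)
      simp only [apply_totalPullback] at h
      exact h
    choose z hz using hcomp
    refine ⟨∑ k ∈ v.support, ofDegree ℂ (ComplexPoints H) k (z k), ?_⟩
    rw [map_sum]
    conv_rhs => rw [← DirectSum.sum_support_of v]
    refine Finset.sum_congr rfl fun k _ ↦ ?_
    rw [totalPullback_lof, lof_eq_of]
    exact congrArg _ (hz k)

/-! ### §4 Degreewise form (APPEND): a class of `Hᵏ(K)` is `Γ(K)`-invariant iff it is a restriction from `A^[n+1]` -/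

section Degreewise

variable {n : ℕ} {A : AbelianVariety ℂ} {K H : SchemeOver ℂ}

/-- **The bridge, degree by degree**: for `n ≥ 2` and a Kummer fibre `j : K ⟶ H` of a Hilbert scheme of `n + 1`
points of the abelian surface `A`, a class `c ∈ Hᵏ(K(ℂ); ℂ)` is `Γ(K)`-invariant (`IsGammaInvariant K c`: fixed by
every automorphism acting trivially on `H²` and `H³`) iff `c = j(ℂ)^* z` for some `z ∈ Hᵏ(H(ℂ); ℂ)` (the form the
bookkeeping consumers and V0's "`R = im θ*`" step read).  CONDITIONAL on the two print facts. -/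
theorem isGammaInvariant_iff_exists_map_eq (hGal : Beauville1983_kummerCover_galois)
    (hBNWS : BNWS2011_autFixingH2H3_generalizedKummer) (hA : A.dim = 2) (hn : 2 ≤ n)
    (Ξ : (A.X ⊗ H).left.IdealSheafData) (𝒜 : Motives.Jacobian H) (x₀ : 𝟙_ (SchemeOver ℂ) ⟶ H) (j : K ⟶ H)
    (hHilb : IsHilbertSchemeOfPoints (n + 1) A.X H Ξ) (hH : IsSmoothProjective (2 * (n + 1)) H)
    (hsq : IsPullback j (toUnit K) (lift (𝟙 H) (toUnit H ≫ x₀) ≫ 𝒜.diff) (1 : 𝟙_ (SchemeOver ℂ) ⟶ 𝒜.J.X))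
    (hKs : IsSmoothProjective (2 * n) K) {k : ℕ} (c : complexBetti K k) :
    IsGammaInvariant K c ↔ ∃ z : complexBetti H k, complexBetti.map j k z = c := by
  have hact : IsTranslationAction Ξ (translationAction hHilb) := isTranslationAction_translationAction hHilb
  constructor
  · intro hc
    refine exists_map_eq_of_kummerTranslation_invariant hGal hA Ξ 𝒜 x₀ j hHilb hH hsq hKs fun b τ hb hτ ↦ ?_
    haveI := hBNWS.isIso hA hn hHilb hH hsq hKs hact hb hτ
    exact hc (asIso τ) (hBNWS.mem_autFixingH2H3 hA hn hHilb hH hsq hKs hact hb hτ)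
  · rintro ⟨z, rfl⟩ g hg
    exact hBNWS.complexBetti_map_pullback_apply_of_mem hA hn hHilb hH hsq hKs hact hg k z

end Degreewise

end Summit.Ventures.HodgeKum4

end
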